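import Mathlib
import HarnessLib
import Summits.Parity.BatemanHorn.Theses.AlmostPrimeZeros

/-!
# Sketch — crux-ideate stmt-Parity-11291 (SystemZeroRepulsion), ideator 1, round 1

First lemmas of the two idea cards, stated over existing declarations (no proofs required here;
everything is a `def … : Prop`, so the file is sorry-free).

* Card `euler-species-factorisation`: `zeroRepulsion`, `localStat`, `eulerFactor`,
  `eulerSpecies`, `roughStat`, `roughPoly`; first lemmas `ZeroRepulsionAdditive`,
  `EulerSpeciesBound`, `LinearExactFactorisation`; transfer target `RoughZeroRepulsion`.
* Card `buchstab-flow-hyperbolicity`: first lemmas `LongCyclesRealRooted`,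
  `HyperbolicDeficit`, `LatticeCountBound`; transfer target `RoughLatticeCount`.
-/

namespace Summit.Parity.BatemanHorn.Cruxes.SystemZeroRepulsion.Sketch

open scoped BigOperators
open Polynomial Filter

/-- The crux's zero functional `T(P) = Σ_ρ |1-ρ|⁻²` (roots over `ℂ`, with multiplicity). -/
noncomputable def zeroRepulsion (P : Polynomial ℂ) : ℝ :=
  (P.roots.map (fun ρ : ℂ => (‖(1 : ℂ) - ρ‖ ^ 2)⁻¹)).sum

/-- The same functional for a real polynomial all of whose roots are real:
`Σ_ρ (1-ρ)⁻²` over the real roots (with multiplicity). -/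
noncomputable def zeroRepulsionReal (P : Polynomial ℝ) : ℝ :=
  (P.roots.map (fun ρ : ℝ => ((1 - ρ) ^ 2)⁻¹)).sum

/-- Capped local statistic at the prime `p`: `s_{f,p}(n) = Σ_i ([p ∣ f_i(n)] + [p² ∣ f_i(n)])`
(`= Σ_i min(v_p(f_i(n)), 2)`, a function of `n mod p²`; `f_i(n) = 0` counts `2`). -/
noncomputable def localStat {k : ℕ} (f : Fin k → Polynomial ℤ) (p n : ℕ) : ℕ :=
  ∑ i, ((if ((p : ℤ) ∣ (f i).eval (n : ℤ)) then 1 else 0) +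
        (if ((p : ℤ) ^ 2 ∣ (f i).eval (n : ℤ)) then 1 else 0))

/-- Euler-species factor at `p`: the (unnormalised) local probability generating polynomial
`E_p(X) = Σ_{n < p²} X^{s_{f,p}(n)} ∈ ℂ[X]`, `E_p(1) = p²`. -/
noncomputable def eulerFactor {k : ℕ} (f : Fin k → Polynomial ℤ) (p : ℕ) : Polynomial ℂ :=
  ∑ n ∈ Finset.range (p ^ 2), (Polynomial.X : Polynomial ℂ) ^ (localStat f p n)

/-- Euler species up to `y`: `M_y = ∏_{p ≤ y, p prime} E_p`. -/
noncomputable def eulerSpecies {k : ℕ} (f : Fin k → Polynomial ℤ) (y : ℕ) : Polynomial ℂ :=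
  ∏ p ∈ (Finset.range (y + 1)).filter Nat.Prime, eulerFactor f p

/-- Rough statistic: prime factors `> y` of the values, multiplicity capped at `2`
(`f_i(n) ≤ 0` contributes `0`, as in the crux). -/
noncomputable def roughStat {k : ℕ} (f : Fin k → Polynomial ℤ) (y n : ℕ) : ℕ :=
  ∑ i, (((f i).eval (n : ℤ)).toNat.factorization.sum fun p v => if y < p then min v 2 else 0)

/-- Rough polynomial `R_{x,y}(X) = Σ_{0 ≤ n ≤ x} X^{(rough statistic of n)}`. -/
noncomputable def roughPoly {k : ℕ} (f : Fin k → Polynomial ℤ) (x y : ℕ) : Polynomial ℂ :=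
  ∑ n ∈ Finset.range (x + 1), (Polynomial.X : Polynomial ℂ) ^ (roughStat f y n)

/-- The small-prime cut-off `y_A(x) = ⌊exp(log x / (log log x)^A)⌋` (so `u = (log log x)^A`). -/
noncomputable def cutoff (A : ℝ) (x : ℕ) : ℕ :=
  Nat.floor (Real.exp (Real.log x / Real.log (Real.log x) ^ A))

/-! ### Card `euler-species-factorisation` -/

/-- First lemma (bookkeeping, provable now): `T` is additive over products, because the roots
of a product are the multiset sum of the roots (`Polynomial.roots_mul`). -/
def ZeroRepulsionAdditive : Prop :=
  ∀ P Q : Polynomial ℂ, P * Q ≠ 0 → zeroRepulsion (P * Q) = zeroRepulsion P + zeroRepulsion Q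

/-- First lemma (provable now, size M): the Euler species of a Bateman–Horn system has
bounded zero repulsion, uniformly in `y`: `T(M_y) = Σ_{p ≤ y} T(E_p) ≤ C_f`.  For a prime `p`
at which the `f_i` have simple, pairwise distinct roots mod `p` and `ω = ω_f(p) ≥ 1`,
`E_p(z)/p² = (1 - ω/p) + ω(p-1)p⁻² z + ω p⁻² z²`, and `E_p(1) = p²` forces
`(1-z₁)(1-z₂) = p²/ω`; since `ω < p` (no fixed prime divisor) both roots are at distance `> 1`
from `1` and `T(E_p) ≤ 2(ω²+1)/p²`; the finitely many remaining primes contribute finitely. -/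
def EulerSpeciesBound : Prop :=
  ∀ (k : ℕ) (f : Fin k → Polynomial ℤ), Literature.NumberTheory.Sieve.IsBatemanHornSystem f →
    ∃ C : ℝ, ∀ y : ℕ, zeroRepulsion (eulerSpecies f y) ≤ C

/-- First lemma, linear case (exact, provable now): for `f = X` the almost-prime polynomial
factorises EXACTLY through the smooth/rough decomposition `n = a·b` (`a` `y`-smooth, `b`
`y`-rough): `Σ_{1 ≤ n ≤ x} z^{s(n)} = Σ_{a ≤ x, a y-smooth} z^{s(a)} · Σ_{b ≤ x/a, b y-rough} z^{s(b)}`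
(`s` the capped statistic; `s(ab) = s(a) + s(b)` for coprime `a, b`). -/
def LinearExactFactorisation : Prop :=
  ∀ (x y : ℕ) (z : ℂ),
    (∑ n ∈ Finset.Icc 1 x, z ^ (n.factorization.sum fun _ v => min v 2)) =
      ∑ a ∈ (Finset.Icc 1 x).filter (fun a => ∀ p ∈ a.primeFactors, p ≤ y),
        z ^ (a.factorization.sum fun _ v => min v 2) *
          ∑ b ∈ (Finset.Icc 1 (x / a)).filter (fun b => ∀ p ∈ b.primeFactors, y < p),
            z ^ (b.factorization.sum fun _ v => min v 2)

/-- Transfer target `C⁺` of the card (rough zero repulsion): with `y = y_A(x)`,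
`u = (log log x)^A`, the rough polynomial alone has bounded zero repulsion. Together with the
coupling `S_x ≈ M_y · R_{x,y}` (zero-stable on `|z-1| ≤ K log log x`) and `EulerSpeciesBound`
this gives the crux. -/
def RoughZeroRepulsion : Prop :=
  ∀ (k : ℕ) (f : Fin k → Polynomial ℤ), Literature.NumberTheory.Sieve.IsBatemanHornSystem f →
    ∀ A : ℝ, 2 ≤ A → ∃ C : ℝ, ∀ x : ℕ, 3 ≤ x → zeroRepulsion (roughPoly f x (cutoff A x)) ≤ C

/-! ### Card `buchstab-flow-hyperbolicity` -/

/-- First lemma (the exactly solvable point; verified by exact Sturm sequences for all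
`n ≤ 36`, `m₀ ∈ {1,2,3,4,6}` in this session): the polynomial counting permutations of `n`
letters by their number of cycles LONGER than `m₀` has only real zeros (for `m₀ = 0` it is the
rising factorial `X(X+1)⋯(X+n-1)`, whose zeros are exactly the lattice `0,-1,…`). Over `ℝ`,
"all roots real" is `roots.card = natDegree`. -/
def LongCyclesRealRooted : Prop :=
  ∀ n m₀ : ℕ,
    (∑ σ : Equiv.Perm (Fin n),
        (Polynomial.X : Polynomial ℝ) ^ (Multiset.card (σ.cycleType.filter fun l => m₀ < l))).roots.card
      = (∑ σ : Equiv.Perm (Fin n),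
        (Polynomial.X : Polynomial ℝ) ^ (Multiset.card (σ.cycleType.filter fun l => m₀ < l))).natDegree

/-- First lemma (provable now; the equality case of the route's `DeficitFromRepulsion`):
for a real-rooted real polynomial with `P(1) ≠ 0`, `Σ_ρ (1-ρ)⁻² = (P'(1)/P(1))² - P''(1)/P(1)`,
i.e. zero repulsion = mean − variance of the coefficient law: a two-moment, parity-blind
quantity. -/
def HyperbolicDeficit : Prop :=
  ∀ P : Polynomial ℝ, P.eval 1 ≠ 0 → P.roots.card = P.natDegree →
    zeroRepulsionReal P =
      ((Polynomial.derivative P).eval 1 / P.eval 1) ^ 2 -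
        (Polynomial.derivative (Polynomial.derivative P)).eval 1 / P.eval 1

/-- First lemma (provable now, Abel summation): lattice domination bounds `T` sharply.
If a complex polynomial has at most `k(m+1)` roots within distance `m+1` of `1` for every
`m : ℕ` (in particular none within distance `1`… read: none with `‖1-ρ‖ < 1`), then
`T(P) ≤ k · π²/6`. (Sort the roots by `‖1-ρ‖`; the `j`-th has `‖1-ρ_j‖ ≥ ⌈j/k⌉`.) -/
def LatticeCountBound : Prop :=
  ∀ (k : ℕ) (P : Polynomial ℂ), P ≠ 0 →
    (∀ m : ℕ, (P.roots.filter fun ρ : ℂ => ‖(1 : ℂ) - ρ‖ < m + 1).card ≤ k * m) →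
      zeroRepulsion P ≤ k * (Real.pi ^ 2 / 6)

/-- Transfer target `C⁺⁺` of the card (rough lattice count): with `y = y_A(x)` the rough
polynomial of a Bateman–Horn system has at most `k·m + C₀` zeros within distance `m+1` of `1`,
for every `m` — the finite-`x` shadow of "its zeros are real and lie to the left of the
lattice points `0,-1,-2,…` (each with multiplicity `k`)". Implies `RoughZeroRepulsion`
by `LatticeCountBound`-type summation. -/
def RoughLatticeCount : Prop :=
  ∀ (k : ℕ) (f : Fin k → Polynomial ℤ), Literature.NumberTheory.Sieve.IsBatemanHornSystem f →
    ∀ A : ℝ, 2 ≤ A → ∃ C₀ : ℕ, ∃ r₀ : ℝ, 0 < r₀ ∧ ∃ x₀ : ℕ, ∀ x : ℕ, x₀ ≤ x →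
      (∀ ρ ∈ (roughPoly f x (cutoff A x)).roots, r₀ ≤ ‖(1 : ℂ) - ρ‖) ∧
      ∀ m : ℕ,
        ((roughPoly f x (cutoff A x)).roots.filter fun ρ : ℂ => ‖(1 : ℂ) - ρ‖ < m + 1).card
          ≤ k * m + C₀

/-- Sanity: the transfer targets and first lemmas are statements about the crux's own objects —
the crux decl itself, for reference (type-checks that the import resolves). -/
example : Prop := Summit.Parity.BatemanHorn.Theses.AlmostPrimeZeros.SystemZeroRepulsion

end Summit.Parity.BatemanHorn.Cruxes.SystemZeroRepulsion.Sketch
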